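import Mathlib
import HarnessLib
import Summits.Ventures.LatticeQCDFlow.Exactness.LatticeBlockSecondMomentTensorization
import Summits.Ventures.LatticeQCDFlow.Exactness.SphereLOFlowEntropyFloorPairs

/-!
# The second-moment barrier for the powers `w^t` of the importance weights of the exact leading-order flow sampler: `(∫w^t dπ̄)²·exp(Σ_j e^{−4tM_j}·t²(max 0 ((c⁴/8)Σ_P Var(E[V_j|ω_P]) − 4ρ_j²))/(1+t²M_j²)) ≤ e^{4t|Λ|δ₁}·∫w^{2t} dπ̄` — `t = 1` the effective-sample-size barrier, `t = 1/2` the acceptance barrier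

HONEST FRAMING: exact (Metropolis-corrected) sampling algorithms for lattice gauge theory;
figures of merit are autocorrelation/cost numbers at stated couplings and volumes; no
continuum-physics claim.

Venture `LatticeQCDFlow` (cell pub-lqcd), topic `Exactness`; FANOUT row 7 (`s0-cpn-null`).  NEW WORK
of the cell over this lineage's `Exactness/LatticeBlockSecondMomentTensorization.lean` (the tensorized
second-moment floor with an approximation error), `Exactness/SphereLOFlowEntropyFloor.lean` (the
cone-localized effective action `|S_eff − (cS₀ + Σ_n g_n)| ≤ |Λ|δ₁`), `…EntropyFloorVariance` /
`…EntropyFloorPairs` (`|g_n| ≤ κ²υ²c²/(d−1)`; `(c⁴/4)Var(A_C V_j) ≤ 2Var(A_C h_j) + 8ρ_j²`;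
`Σ_P Var(E[V_j|ω_P]) ≤ Var(A_C V_j)`), `Exactness/LatticeBlockPartition.lean` and
`Exactness/SphereLOFlowLocalizedSiteTerms.lean`; nothing is cited as a fact.  Printed counterparts,
NAMED ONLY: Engel–Schaefer 2011 §3; Lüscher 2010; Abbott et al., Phys. Rev. D 106 (2022) 074506, §V.
THE SAMPLER-QUALITY FORM OF THE BARRIER.  The tree's `Exactness/SphereLOFlowEffectiveAction.sq_integral_loWeight_ge`
(GEN-15) bounds the effective-sample-size fraction `(∫w dπ̄)²/∫w² dπ̄` of the uncorrected exact LO flow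
sampler (importance weights `w = exp(ℓ_{0→c} − c·S∘Φ_{0→c})` against the target `e^{−cS}π̄/Z_c`) from
BELOW by `exp(−(c²/2)M)`; here the CEILING, for every power `w^t = exp(t(ℓ_{0→c} − c·S∘Φ_{0→c}))`,
`t ≥ 0`, of the weights: for blocks `B_j` whose radius-`(m+1)` cone neighbourhoods are pairwise disjoint
(every two balls `nball N (m+1) n`, `nball N (m+1) n'` meeting different blocks are disjoint), and
pairwise disjoint groups of spins `P ∈ Pf j` inside the blocks,
`(∫w^t dπ̄)² · exp(Σ_j e^{−4tM_j}·t²·(max 0 ((c⁴/8)·Σ_{P∈Pf j} Var(E[V_j | ω_P]) − 4ρ_j²))/(1 + t²M_j²)) ≤ e^{4t|Λ|δ₁}·∫w^{2t} dπ̄`,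
`M_j = 2|I_j|κ²υ²c²/(d−1)`, `ρ_j = |I_j|(4|κ|³υ³/(d−1)²)c³`, `δ₁ = (6κ²υ²/(d−1))c²·2e^{Kc}(Kc)^{m+1}/(m+1)!`
(the log-weight `t·S_eff` is within `t|Λ|δ₁` of a sum of block-local terms `t·h_j` of oscillation
`≤ t·M_j` plus a corridor term).  At `t = 1` this is the EFFECTIVE-SAMPLE-SIZE barrier: the ESS
fraction is at most `e^{4|Λ|δ₁}` times a PRODUCT over blocks of factors `< 1` — for congruent blocks
`exp(−#blocks·Ω(c⁴) + |Λ|·O(c^{m+3}))`, EXPONENTIALLY SMALL IN THE VOLUME at fixed small flow time; at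
`t = 1/2` the left side dominates the mean Metropolis acceptance of the flow-based independence sampler
(`Exactness/SphereIndependenceSamplerAcceptanceCeiling.lean`: `acc ≤ (∫w^{1/2})²/∫w`), which is the
sequel's ACCEPTANCE barrier.

## Content

* **`sq_integral_loWeight_pow_mul_exp_le`** — the displayed inequality for every `t ≥ 0`;
* **`sq_integral_loWeight_mul_exp_le`** — its `t = 1` instance (the ESS barrier).

NOT CLAIMED: the evaluation for specific couplings (sequel: the torus link model); autocorrelations
of the Metropolis-corrected chain; numbers.
-/


noncomputable section

namespace Summit.Ventures.LatticeQCDFlow.Exactness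

open Function Set Metric MeasureTheory NormedSpace InnerProductSpace InformationTheory
open scoped RealInnerProductSpace Topology Nat Classical

variable {Λ : Type*} {E : Type*} [NormedAddCommGroup E] [InnerProductSpace ℝ E]
  [FiniteDimensional ℝ E] [Fintype Λ] [DecidableEq Λ]

section ESS

variable [MeasurableSpace E] [BorelSpace E] [Nontrivial E] {U : Λ → Λ → (E →L[ℝ] E)} {T : ℝ}


set_option maxHeartbeats 400000 in
/-- **THE SECOND-MOMENT BARRIER FOR THE POWERS OF THE WEIGHTS OF THE EXACT LEADING-ORDER FLOW
SAMPLER.**  No self-coupling, adjoint pairs, `Σ_m‖U_nm‖ ≤ υ`, `d ≥ 2`, `0 ≤ c ≤ |T| + 1`; blocks `B_j`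
(`j ∈ T_b`) such that any two radius-`(m+1)` balls of `N n = {n} ∪ couplingNbhd U n` meeting different
blocks are disjoint; in each block a family `Pf j` of pairwise disjoint groups of spins off the
corridors; `g_n` the cone-localized site terms; `t ≥ 0`.  Then with
`I_j = {n : nball N (m+1) n ∩ B_j ≠ ∅}`, `M_j = 2|I_j|κ²υ²c²/(d−1)`, `ρ_j = |I_j|(4|κ|³υ³/(d−1)²)c³` and
`w = exp(ℓ_{0→c} − c·S∘Φ_{0→c})`:
`(∫w^t dπ̄)²·exp(Σ_j e^{−4tM_j}·t²(max 0 ((c⁴/8)Σ_{P∈Pf j}Var(A_{Λ∖P}V_j) − 4ρ_j²))/(1+(tM_j)²)) ≤ e^{4t|Λ|δ₁}·∫w^{2t} dπ̄`. -/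
theorem sq_integral_loWeight_pow_mul_exp_le (hU0 : ∀ n, U n n = 0)
    (hUadj : ∀ m n (v w : E), ⟪U m n v, w⟫ = ⟪v, U n m w⟫) (hd : 2 ≤ Module.finrank ℝ E)
    (κ S₀ : ℝ) {υ : ℝ} (hυ : ∀ k, ∑ m, ‖U k m‖ ≤ υ) {c : ℝ} (hc0 : 0 ≤ c) (hc : c ≤ |T| + 1)
    {e : Λ → E} (he : ∀ n, ‖e n‖ = 1) (m : ℕ)
    {g : Λ → (Λ → sphere (0 : E) 1) → ℝ}
    (hg : ∀ n ω, g n ω = -∫ u in (0 : ℝ)..c, u * (2 * κ ^ 2 / ((Module.finrank ℝ E : ℝ) - 1) *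
      ‖tangentKick (localField U n (sphereTDFlow (G := fun _ : ℝ => loFlowAction κ S₀ U)
          (contDiff_const_family (contDiff_loFlowAction U κ S₀)) T 0 u
          ((nball (fun k => insert k (couplingNbhd U k)) (m + 1) n).piecewise
            (fun i => ((ω i : sphere (0 : E) 1) : E)) e)))
        (sphereTDFlow (G := fun _ : ℝ => loFlowAction κ S₀ U)
          (contDiff_const_family (contDiff_loFlowAction U κ S₀)) T 0 u
          ((nball (fun k => insert k (couplingNbhd U k)) (m + 1) n).piecewise
            (fun i => ((ω i : sphere (0 : E) 1) : E)) e) n)‖ ^ 2))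
    {J : Type*} (Tb : Finset J) (B : J → Finset Λ)
    (hsep2 : ∀ n n', ∀ j ∈ Tb, ∀ j' ∈ Tb, j ≠ j' →
      ¬ Disjoint (nball (fun k => insert k (couplingNbhd U k)) (m + 1) n) ↑(B j) →
      ¬ Disjoint (nball (fun k => insert k (couplingNbhd U k)) (m + 1) n') ↑(B j') →
      Disjoint (nball (fun k => insert k (couplingNbhd U k)) (m + 1) n)
        (nball (fun k => insert k (couplingNbhd U k)) (m + 1) n'))
    (Pf : J → Finset (Finset Λ))
    (hP : ∀ j ∈ Tb, ∀ P ∈ Pf j, ∀ P' ∈ Pf j, P ≠ P' → Disjoint P P')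
    (hPC : ∀ j ∈ Tb, ∀ P ∈ Pf j, Disjoint P (Finset.univ \ Tb.biUnion B)) {t : ℝ} (ht : 0 ≤ t) :
    (∫ ω, Real.exp (t * (sphereTDFlowLogJac (G := fun _ : ℝ => loFlowAction κ S₀ U)
          (contDiff_const_family (contDiff_loFlowAction U κ S₀)) T 0 c
            (fun i => ((ω : Λ → sphere (0 : E) 1) i : E)) -
          c * esAction κ S₀ U (sphereTDFlow (G := fun _ : ℝ => loFlowAction κ S₀ U)
            (contDiff_const_family (contDiff_loFlowAction U κ S₀)) T 0 c (fun i => (ω i : E)))))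
        ∂Measure.pi (fun _ : Λ => uniformSphere (volume : Measure E))) ^ 2 *
      Real.exp (∑ j ∈ Tb, Real.exp (-4 * (t * (2 * ((Finset.univ.filter (fun n =>
            ¬ Disjoint (nball (fun k => insert k (couplingNbhd U k)) (m + 1) n) ↑(B j))).card * (κ ^ 2 * υ ^ 2 / ((Module.finrank ℝ E : ℝ) - 1) * c ^ 2))))) *
        (t ^ 2 * max 0 (c ^ 4 / 8 * ∑ P ∈ Pf j, ∫ ω,
          (coordAvg (uniformSphere (volume : Measure E)) (Finset.univ \ P)
            (fun ω => ∑ n ∈ (Finset.univ.filter (fun n =>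
            ¬ Disjoint (nball (fun k => insert k (couplingNbhd U k)) (m + 1) n) ↑(B j))),
              2 * κ ^ 2 / ((Module.finrank ℝ E : ℝ) - 1) *
                ‖tangentKick (localField U n (fun i => ((ω i : sphere (0 : E) 1) : E))) (ω n : E)‖ ^ 2) ω -
          ∫ ω', (∑ n ∈ (Finset.univ.filter (fun n =>
            ¬ Disjoint (nball (fun k => insert k (couplingNbhd U k)) (m + 1) n) ↑(B j))),
              2 * κ ^ 2 / ((Module.finrank ℝ E : ℝ) - 1) *
                ‖tangentKick (localField U n (fun i => ((ω' i : sphere (0 : E) 1) : E))) (ω' n : E)‖ ^ 2)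
            ∂Measure.pi (fun _ : Λ => uniformSphere (volume : Measure E))) ^ 2
          ∂Measure.pi (fun _ : Λ => uniformSphere (volume : Measure E)) -
          4 * ((Finset.univ.filter (fun n =>
            ¬ Disjoint (nball (fun k => insert k (couplingNbhd U k)) (m + 1) n) ↑(B j))).card * (4 * |κ| ^ 3 * υ ^ 3 / ((Module.finrank ℝ E : ℝ) - 1) ^ 2 * c ^ 3)) ^ 2)) / (1 + (t * (2 * ((Finset.univ.filter (fun n =>
            ¬ Disjoint (nball (fun k => insert k (couplingNbhd U k)) (m + 1) n) ↑(B j))).card * (κ ^ 2 * υ ^ 2 / ((Module.finrank ℝ E : ℝ) - 1) * c ^ 2)))) ^ 2)) ≤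
      Real.exp (4 * (t * (Fintype.card Λ * (6 * κ ^ 2 * υ ^ 2 / ((Module.finrank ℝ E : ℝ) - 1) * c ^ 2 *
        (2 * Real.exp (3 * |κ| * υ / ((Module.finrank ℝ E : ℝ) - 1) * c) *
          (3 * |κ| * υ / ((Module.finrank ℝ E : ℝ) - 1) * c) ^ (m + 1) / ((m + 1)! : ℝ)))))) *
      ∫ ω, Real.exp (t * (sphereTDFlowLogJac (G := fun _ : ℝ => loFlowAction κ S₀ U)
          (contDiff_const_family (contDiff_loFlowAction U κ S₀)) T 0 c
            (fun i => ((ω : Λ → sphere (0 : E) 1) i : E)) -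
          c * esAction κ S₀ U (sphereTDFlow (G := fun _ : ℝ => loFlowAction κ S₀ U)
            (contDiff_const_family (contDiff_loFlowAction U κ S₀)) T 0 c (fun i => (ω i : E))))) ^ 2
        ∂Measure.pi (fun _ : Λ => uniformSphere (volume : Measure E)) := by
  set N : Λ → Set Λ := fun k => insert k (couplingNbhd U k) with hN
  set μ : Measure (Λ → sphere (0 : E) 1) := Measure.pi (fun _ : Λ => uniformSphere (volume : Measure E))
    with hμ
  set F : (Λ → sphere (0 : E) 1) → ℝ := fun ω =>
    c * esAction κ S₀ U (sphereTDFlow (G := fun _ : ℝ => loFlowAction κ S₀ U)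
        (contDiff_const_family (contDiff_loFlowAction U κ S₀)) T 0 c (fun i => (ω i : E))) -
      sphereTDFlowLogJac (G := fun _ : ℝ => loFlowAction κ S₀ U)
        (contDiff_const_family (contDiff_loFlowAction U κ S₀)) T 0 c (fun i => (ω i : E)) with hF
  have hFc : Continuous F := continuous_effAction_loFlow (U := U) κ S₀ c (T := T)
  -- separation: one ball meets at most one block; blocks are disjoint
  have hsep : ∀ n, ∀ j ∈ Tb, ∀ j' ∈ Tb, ¬ Disjoint (nball N (m + 1) n) ↑(B j) →
      ¬ Disjoint (nball N (m + 1) n) ↑(B j') → j = j' := by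
    intro n j hj j' hj' h1 h2
    by_contra hne
    have hdis := hsep2 n n j hj j' hj' hne h1 h2
    exact Set.disjoint_left.1 hdis (self_mem_nball (m + 1) n) (self_mem_nball (m + 1) n)
  -- the block data
  set h : J → (Λ → sphere (0 : E) 1) → ℝ := fun j ω =>
    ∑ n ∈ Finset.univ.filter (fun n => ¬ Disjoint (nball N (m + 1) n) ↑(B j)), g n ω with hh
  set r : (Λ → sphere (0 : E) 1) → ℝ := fun ω =>
    c * S₀ + ∑ n ∈ Finset.univ.filter (fun n => ∀ j ∈ Tb, Disjoint (nball N (m + 1) n) ↑(B j)), g n ω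
    with hr
  set D : J → Finset Λ := fun j => Finset.univ.filter (fun i => ∃ n, ¬ Disjoint (nball N (m + 1) n) ↑(B j) ∧
    i ∈ nball N (m + 1) n) with hD
  have hgc : ∀ n, Continuous (g n) := continuous_loLocalTerm (U := U) κ S₀ e m c hg (T := T)
  have hgdep : ∀ n, DependsOn (g n) (nball N (m + 1) n) := dependsOn_loLocalTerm (U := U) κ S₀ e m c hg (T := T)
  have hhc : ∀ j ∈ Tb, Continuous (h j) := fun j _ => continuous_finsetSum _ fun n _ => hgc n
  have hhdep : ∀ j ∈ Tb, DependsOn (h j) ↑(D j) := by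
    intro j hj
    refine DependsOn.mono ?_ (dependsOn_finset_sum _ (fun n => nball N (m + 1) n) fun n _ => hgdep n)
    intro i hi
    obtain ⟨n, hn, hin⟩ := Set.mem_iUnion₂.1 hi
    exact Finset.mem_coe.2 (Finset.mem_filter.2 ⟨Finset.mem_univ _, n, (Finset.mem_filter.1 hn).2, hin⟩)
  have hBD : ∀ j ∈ Tb, B j ⊆ D j := fun j hj b hb =>
    Finset.mem_filter.2 ⟨Finset.mem_univ _, b, Set.not_disjoint_iff.2 ⟨b, self_mem_nball _ b, hb⟩, self_mem_nball _ b⟩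
  have hDdisj : ∀ j ∈ Tb, ∀ j' ∈ Tb, j ≠ j' → Disjoint (D j) (D j') := by
    intro j hj j' hj' hne
    rw [Finset.disjoint_left]
    intro i hi hi'
    obtain ⟨n, hn, hin⟩ := (Finset.mem_filter.1 hi).2
    obtain ⟨n', hn', hin'⟩ := (Finset.mem_filter.1 hi').2
    exact Set.disjoint_left.1 (hsep2 n n' j hj j' hj' hne hn hn') hin hin'
  -- oscillation of the block terms
  have hM : ∀ j ∈ Tb, ∀ ω ω', |h j ω - h j ω'| ≤
      2 * ((Finset.univ.filter (fun n => ¬ Disjoint (nball N (m + 1) n) ↑(B j))).card *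
        (κ ^ 2 * υ ^ 2 / ((Module.finrank ℝ E : ℝ) - 1) * c ^ 2)) := by
    intro j hj ω ω'
    have hb : ∀ ω₁, |h j ω₁| ≤ (Finset.univ.filter (fun n => ¬ Disjoint (nball N (m + 1) n) ↑(B j))).card *
        (κ ^ 2 * υ ^ 2 / ((Module.finrank ℝ E : ℝ) - 1) * c ^ 2) := by
      intro ω₁
      simp only [hh]
      refine (Finset.abs_sum_le_sum_abs _ _).trans ?_
      refine (Finset.sum_le_sum fun n _ => abs_loLocalTerm_le hd κ S₀ hυ he m hc0 hg n ω₁ (T := T)).trans ?_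
      rw [Finset.sum_const, nsmul_eq_mul]
    have := abs_sub _ _ |>.trans (add_le_add (hb ω) (hb ω'))
    linarith
  have hM0 : ∀ j ∈ Tb, 0 ≤ 2 * ((Finset.univ.filter (fun n => ¬ Disjoint (nball N (m + 1) n) ↑(B j))).card *
      (κ ^ 2 * υ ^ 2 / ((Module.finrank ℝ E : ℝ) - 1) * c ^ 2)) := by
    intro j hj
    have hd1 : (0 : ℝ) < (Module.finrank ℝ E : ℝ) - 1 := by
      have : (2 : ℝ) ≤ Module.finrank ℝ E := by exact_mod_cast hd
      linarith
    positivity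
  have hrc : Continuous r := continuous_const.add (continuous_finsetSum _ fun n _ => hgc n)
  have hrdep : DependsOn r (↑(Tb.biUnion B) : Set Λ)ᶜ := by
    intro ω ω' hagree
    have hagree' : ∀ i ∈ (↑(Finset.univ \ Tb.biUnion B) : Set Λ), ω i = ω' i := fun i hi =>
      hagree i (by simpa [Finset.mem_sdiff] using hi)
    have hfree := dependsOn_freeSum (fun n => nball N (m + 1) n) Tb B hgdep hagree'
    simp only at hfree
    show c * S₀ + _ = c * S₀ + _
    rw [hfree]
  -- the localization error
  have hδ : ∀ ω, |F ω - (∑ j ∈ Tb, h j ω + r ω)| ≤ Fintype.card Λ * (6 * κ ^ 2 * υ ^ 2 / ((Module.finrank ℝ E : ℝ) - 1) * c ^ 2 *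
        (2 * Real.exp (3 * |κ| * υ / ((Module.finrank ℝ E : ℝ) - 1) * c) *
          (3 * |κ| * υ / ((Module.finrank ℝ E : ℝ) - 1) * c) ^ (m + 1) / ((m + 1)! : ℝ))) := by
    intro ω
    have hsplit : ∑ j ∈ Tb, h j ω + r ω = c * S₀ + ∑ n, g n ω := by
      rw [sum_eq_sum_blocks_add_sum_free (fun n => nball N (m + 1) n) Tb B hsep (fun n => g n ω)]
      simp only [hh, hr]
      ring
    rw [hsplit]
    exact abs_effAction_loFlow_sub_local_le hU0 hUadj hd κ S₀ hυ he m hc0 hc hg ω (T := T)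
  -- the scaled data `t·F`, `t·h_j`, `t·r`
  set Ft : (Λ → sphere (0 : E) 1) → ℝ := fun ω => t * F ω with hFt
  set hs : J → (Λ → sphere (0 : E) 1) → ℝ := fun j ω => t * h j ω with hhs
  set rs : (Λ → sphere (0 : E) 1) → ℝ := fun ω => t * r ω with hrs
  have hFtc : Continuous Ft := continuous_const.mul hFc
  have hhsc : ∀ j ∈ Tb, Continuous (hs j) := fun j hj => continuous_const.mul (hhc j hj)
  have hhsdep : ∀ j ∈ Tb, DependsOn (hs j) ↑(D j) := fun j hj ω ω' hag => by
    show t * h j ω = t * h j ω'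
    rw [hhdep j hj hag]
  have hMs : ∀ j ∈ Tb, ∀ ω ω', |hs j ω - hs j ω'| ≤
      t * (2 * ((Finset.univ.filter (fun n => ¬ Disjoint (nball N (m + 1) n) ↑(B j))).card *
        (κ ^ 2 * υ ^ 2 / ((Module.finrank ℝ E : ℝ) - 1) * c ^ 2))) := by
    intro j hj ω ω'
    show |t * h j ω - t * h j ω'| ≤ _
    rw [← mul_sub, abs_mul, abs_of_nonneg ht]
    exact mul_le_mul_of_nonneg_left (hM j hj ω ω') ht
  have hMs0 : ∀ j ∈ Tb, 0 ≤ t * (2 * ((Finset.univ.filter (fun n => ¬ Disjoint (nball N (m + 1) n) ↑(B j))).card *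
      (κ ^ 2 * υ ^ 2 / ((Module.finrank ℝ E : ℝ) - 1) * c ^ 2))) := fun j hj => mul_nonneg ht (hM0 j hj)
  have hrsc : Continuous rs := continuous_const.mul hrc
  have hrsdep : DependsOn rs (↑(Tb.biUnion B) : Set Λ)ᶜ := fun ω ω' hag => by
    show t * r ω = t * r ω'
    rw [hrdep hag]
  have hδs : ∀ ω, |Ft ω - (∑ j ∈ Tb, hs j ω + rs ω)| ≤ t * (Fintype.card Λ * (6 * κ ^ 2 * υ ^ 2 / ((Module.finrank ℝ E : ℝ) - 1) * c ^ 2 *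
        (2 * Real.exp (3 * |κ| * υ / ((Module.finrank ℝ E : ℝ) - 1) * c) *
          (3 * |κ| * υ / ((Module.finrank ℝ E : ℝ) - 1) * c) ^ (m + 1) / ((m + 1)! : ℝ)))) := by
    intro ω
    have e1 : Ft ω - (∑ j ∈ Tb, hs j ω + rs ω) = t * (F ω - (∑ j ∈ Tb, h j ω + r ω)) := by
      simp only [hFt, hhs, hrs]
      rw [← Finset.mul_sum]
      ring
    rw [e1, abs_mul, abs_of_nonneg ht]
    exact mul_le_mul_of_nonneg_left (hδ ω) ht
  -- the generic tensorized floor for the scaled data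
  have hmain := sq_integral_exp_neg_mul_exp_le_of_abs_sub_le (uniformSphere (volume : Measure E)) Tb B D
    hBD hDdisj hhsc hhsdep hMs0 hMs hrsc hrsdep hFtc hδs
  -- `e^{−tF} = w^t`, `e^{−2tF} = (w^t)²`
  have hw1 : ∫ ω, Real.exp (-Ft ω) ∂μ = ∫ ω, Real.exp (t * (sphereTDFlowLogJac (G := fun _ : ℝ => loFlowAction κ S₀ U)
          (contDiff_const_family (contDiff_loFlowAction U κ S₀)) T 0 c
            (fun i => ((ω : Λ → sphere (0 : E) 1) i : E)) -
          c * esAction κ S₀ U (sphereTDFlow (G := fun _ : ℝ => loFlowAction κ S₀ U)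
            (contDiff_const_family (contDiff_loFlowAction U κ S₀)) T 0 c (fun i => (ω i : E))))) ∂μ := by
    refine integral_congr_ae (ae_of_all _ fun ω => ?_)
    simp only [hFt, hF]
    congr 1
    ring
  have hw2 : ∫ ω, Real.exp (-2 * Ft ω) ∂μ = ∫ ω, Real.exp (t * (sphereTDFlowLogJac (G := fun _ : ℝ => loFlowAction κ S₀ U)
          (contDiff_const_family (contDiff_loFlowAction U κ S₀)) T 0 c
            (fun i => ((ω : Λ → sphere (0 : E) 1) i : E)) -
          c * esAction κ S₀ U (sphereTDFlow (G := fun _ : ℝ => loFlowAction κ S₀ U)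
            (contDiff_const_family (contDiff_loFlowAction U κ S₀)) T 0 c (fun i => (ω i : E))))) ^ 2 ∂μ := by
    refine integral_congr_ae (ae_of_all _ fun ω => ?_)
    simp only [hFt, hF]
    rw [← Real.exp_nat_mul]
    congr 1
    push_cast
    ring
  rw [hw1, hw2] at hmain
  -- monotonicity in the block variances: `Var(A_C (t h_j)) = t²Var(A_C h_j) ≥ t²·max 0 (…)`
  refine le_trans ?_ hmain
  refine mul_le_mul_of_nonneg_left (Real.exp_le_exp.2 (Finset.sum_le_sum fun j hj => ?_)) (sq_nonneg _)
  refine div_le_div_of_nonneg_right (mul_le_mul_of_nonneg_left ?_ (Real.exp_pos _).le) (by positivity)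
  have hA : ∀ ω, coordAvg (uniformSphere (volume : Measure E)) (Finset.univ \ Tb.biUnion B) (hs j) ω =
      t * coordAvg (uniformSphere (volume : Measure E)) (Finset.univ \ Tb.biUnion B) (h j) ω := fun ω =>
    coordAvg_mul_left (uniformSphere (volume : Measure E)) (Finset.univ \ Tb.biUnion B)
      (Φ := fun _ => t) (fun _ _ => rfl) ω
  have hIs : ∫ ω', hs j ω' ∂μ = t * ∫ ω', h j ω' ∂μ := integral_const_mul _ _
  have hV : ∫ ω, (coordAvg (uniformSphere (volume : Measure E)) (Finset.univ \ Tb.biUnion B) (hs j) ω -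
        ∫ ω', hs j ω' ∂μ) ^ 2 ∂μ =
      t ^ 2 * ∫ ω, (coordAvg (uniformSphere (volume : Measure E)) (Finset.univ \ Tb.biUnion B) (h j) ω -
        ∫ ω', h j ω' ∂μ) ^ 2 ∂μ := by
    rw [← integral_const_mul]
    refine integral_congr_ae (ae_of_all _ fun ω => ?_)
    show (coordAvg (uniformSphere (volume : Measure E)) (Finset.univ \ Tb.biUnion B) (hs j) ω -
        ∫ ω', hs j ω' ∂μ) ^ 2 =
      t ^ 2 * (coordAvg (uniformSphere (volume : Measure E)) (Finset.univ \ Tb.biUnion B) (h j) ω -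
        ∫ ω', h j ω' ∂μ) ^ 2
    rw [hA ω, hIs]
    ring
  rw [hV]
  refine mul_le_mul_of_nonneg_left ?_ (sq_nonneg t)
  refine max_le (integral_nonneg fun ω => sq_nonneg _) ?_
  have hstat := variance_coordAvg_static_le hU0 hUadj hd κ S₀ hυ he m hc0 hc hg
    (Finset.univ.filter (fun n => ¬ Disjoint (nball N (m + 1) n) ↑(B j))) (Finset.univ \ Tb.biUnion B) (T := T)
  have hVc : Continuous fun ω : Λ → sphere (0 : E) 1 => ∑ n ∈ Finset.univ.filter (fun n =>
      ¬ Disjoint (nball N (m + 1) n) ↑(B j)), 2 * κ ^ 2 / ((Module.finrank ℝ E : ℝ) - 1) *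
        ‖tangentKick (localField U n (fun i => ((ω i : sphere (0 : E) 1) : E))) (ω n : E)‖ ^ 2 := by
    refine continuous_finsetSum _ fun n _ => ?_
    have hJ : Continuous fun η : Λ → sphere (0 : E) 1 =>
        localField U n (fun i => ((η i : sphere (0 : E) 1) : E)) :=
      (contDiff_localField U n (m := 0)).continuous.comp continuous_sphereConfig
    have hx : Continuous fun η : Λ → sphere (0 : E) 1 => ((η n : sphere (0 : E) 1) : E) :=
      continuous_subtype_val.comp (continuous_apply n)
    unfold tangentKick
    exact continuous_const.mul ((hJ.sub ((hJ.inner hx).smul hx)).norm.pow 2)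
  have hpairs := sum_variance_condExp_le_variance_coordAvg (E := E) (Pf j) (fun P => P) (hP j hj)
    (Finset.univ \ Tb.biUnion B) (hPC j hj) hVc
  have hp' := mul_le_mul_of_nonneg_left hpairs (by positivity : (0 : ℝ) ≤ c ^ 4 / 8)
  simp only [hh]
  linarith [hstat, hp']

set_option maxHeartbeats 400000 in
/-- **THE EFFECTIVE-SAMPLE-SIZE BARRIER FOR THE EXACT LEADING-ORDER FLOW SAMPLER** (`t = 1`): with the
hypotheses and notation of `sq_integral_loWeight_pow_mul_exp_le`,
`(∫w dπ̄)²·exp(Σ_j e^{−4M_j}(max 0 ((c⁴/8)Σ_{P∈Pf j}Var(A_{Λ∖P}V_j) − 4ρ_j²))/(1+M_j²)) ≤ e^{4|Λ|δ₁}·∫w² dπ̄`. -/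
theorem sq_integral_loWeight_mul_exp_le (hU0 : ∀ n, U n n = 0)
    (hUadj : ∀ m n (v w : E), ⟪U m n v, w⟫ = ⟪v, U n m w⟫) (hd : 2 ≤ Module.finrank ℝ E)
    (κ S₀ : ℝ) {υ : ℝ} (hυ : ∀ k, ∑ m, ‖U k m‖ ≤ υ) {c : ℝ} (hc0 : 0 ≤ c) (hc : c ≤ |T| + 1)
    {e : Λ → E} (he : ∀ n, ‖e n‖ = 1) (m : ℕ)
    {g : Λ → (Λ → sphere (0 : E) 1) → ℝ}
    (hg : ∀ n ω, g n ω = -∫ u in (0 : ℝ)..c, u * (2 * κ ^ 2 / ((Module.finrank ℝ E : ℝ) - 1) *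
      ‖tangentKick (localField U n (sphereTDFlow (G := fun _ : ℝ => loFlowAction κ S₀ U)
          (contDiff_const_family (contDiff_loFlowAction U κ S₀)) T 0 u
          ((nball (fun k => insert k (couplingNbhd U k)) (m + 1) n).piecewise
            (fun i => ((ω i : sphere (0 : E) 1) : E)) e)))
        (sphereTDFlow (G := fun _ : ℝ => loFlowAction κ S₀ U)
          (contDiff_const_family (contDiff_loFlowAction U κ S₀)) T 0 u
          ((nball (fun k => insert k (couplingNbhd U k)) (m + 1) n).piecewise
            (fun i => ((ω i : sphere (0 : E) 1) : E)) e) n)‖ ^ 2))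
    {J : Type*} (Tb : Finset J) (B : J → Finset Λ)
    (hsep2 : ∀ n n', ∀ j ∈ Tb, ∀ j' ∈ Tb, j ≠ j' →
      ¬ Disjoint (nball (fun k => insert k (couplingNbhd U k)) (m + 1) n) ↑(B j) →
      ¬ Disjoint (nball (fun k => insert k (couplingNbhd U k)) (m + 1) n') ↑(B j') →
      Disjoint (nball (fun k => insert k (couplingNbhd U k)) (m + 1) n)
        (nball (fun k => insert k (couplingNbhd U k)) (m + 1) n'))
    (Pf : J → Finset (Finset Λ))
    (hP : ∀ j ∈ Tb, ∀ P ∈ Pf j, ∀ P' ∈ Pf j, P ≠ P' → Disjoint P P')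
    (hPC : ∀ j ∈ Tb, ∀ P ∈ Pf j, Disjoint P (Finset.univ \ Tb.biUnion B)) :
    (∫ ω, Real.exp (sphereTDFlowLogJac (G := fun _ : ℝ => loFlowAction κ S₀ U)
          (contDiff_const_family (contDiff_loFlowAction U κ S₀)) T 0 c
            (fun i => ((ω : Λ → sphere (0 : E) 1) i : E)) -
          c * esAction κ S₀ U (sphereTDFlow (G := fun _ : ℝ => loFlowAction κ S₀ U)
            (contDiff_const_family (contDiff_loFlowAction U κ S₀)) T 0 c (fun i => (ω i : E))))
        ∂Measure.pi (fun _ : Λ => uniformSphere (volume : Measure E))) ^ 2 *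
      Real.exp (∑ j ∈ Tb, Real.exp (-4 * (2 * ((Finset.univ.filter (fun n =>
            ¬ Disjoint (nball (fun k => insert k (couplingNbhd U k)) (m + 1) n) ↑(B j))).card * (κ ^ 2 * υ ^ 2 / ((Module.finrank ℝ E : ℝ) - 1) * c ^ 2)))) *
        (max 0 (c ^ 4 / 8 * ∑ P ∈ Pf j, ∫ ω,
          (coordAvg (uniformSphere (volume : Measure E)) (Finset.univ \ P)
            (fun ω => ∑ n ∈ (Finset.univ.filter (fun n =>
            ¬ Disjoint (nball (fun k => insert k (couplingNbhd U k)) (m + 1) n) ↑(B j))),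
              2 * κ ^ 2 / ((Module.finrank ℝ E : ℝ) - 1) *
                ‖tangentKick (localField U n (fun i => ((ω i : sphere (0 : E) 1) : E))) (ω n : E)‖ ^ 2) ω -
          ∫ ω', (∑ n ∈ (Finset.univ.filter (fun n =>
            ¬ Disjoint (nball (fun k => insert k (couplingNbhd U k)) (m + 1) n) ↑(B j))),
              2 * κ ^ 2 / ((Module.finrank ℝ E : ℝ) - 1) *
                ‖tangentKick (localField U n (fun i => ((ω' i : sphere (0 : E) 1) : E))) (ω' n : E)‖ ^ 2)
            ∂Measure.pi (fun _ : Λ => uniformSphere (volume : Measure E))) ^ 2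
          ∂Measure.pi (fun _ : Λ => uniformSphere (volume : Measure E)) -
          4 * ((Finset.univ.filter (fun n =>
            ¬ Disjoint (nball (fun k => insert k (couplingNbhd U k)) (m + 1) n) ↑(B j))).card * (4 * |κ| ^ 3 * υ ^ 3 / ((Module.finrank ℝ E : ℝ) - 1) ^ 2 * c ^ 3)) ^ 2)) / (1 + (2 * ((Finset.univ.filter (fun n =>
            ¬ Disjoint (nball (fun k => insert k (couplingNbhd U k)) (m + 1) n) ↑(B j))).card * (κ ^ 2 * υ ^ 2 / ((Module.finrank ℝ E : ℝ) - 1) * c ^ 2))) ^ 2)) ≤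
      Real.exp (4 * (Fintype.card Λ * (6 * κ ^ 2 * υ ^ 2 / ((Module.finrank ℝ E : ℝ) - 1) * c ^ 2 *
        (2 * Real.exp (3 * |κ| * υ / ((Module.finrank ℝ E : ℝ) - 1) * c) *
          (3 * |κ| * υ / ((Module.finrank ℝ E : ℝ) - 1) * c) ^ (m + 1) / ((m + 1)! : ℝ))))) *
      ∫ ω, Real.exp (sphereTDFlowLogJac (G := fun _ : ℝ => loFlowAction κ S₀ U)
          (contDiff_const_family (contDiff_loFlowAction U κ S₀)) T 0 c
            (fun i => ((ω : Λ → sphere (0 : E) 1) i : E)) -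
          c * esAction κ S₀ U (sphereTDFlow (G := fun _ : ℝ => loFlowAction κ S₀ U)
            (contDiff_const_family (contDiff_loFlowAction U κ S₀)) T 0 c (fun i => (ω i : E)))) ^ 2
        ∂Measure.pi (fun _ : Λ => uniformSphere (volume : Measure E)) := by
  have h1 := sq_integral_loWeight_pow_mul_exp_le hU0 hUadj hd κ S₀ hυ hc0 hc he m hg Tb B hsep2 Pf hP hPC (T := T) zero_le_one
  simpa only [one_mul, one_pow] using h1

end ESS

end Summit.Ventures.LatticeQCDFlow.Exactness

end
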